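import Mathlib
import Summits.ResolutionOfSingularities.ResolutionOfSingularities.Theses.HomologicalConductor
import Summits.ResolutionOfSingularities.ResolutionOfSingularities.Theorems.HomologicalConductorNoZenoBirthDefs
import Summits.ResolutionOfSingularities.ResolutionOfSingularities.Theorems.HomologicalConductorPersistenceKC3NormalLoc
import Summits.ResolutionOfSingularities.ResolutionOfSingularities.Theorems.HomologicalConductorPersistenceMonomialValuationKC3
import Summits.ResolutionOfSingularities.ResolutionOfSingularities.Theorems.HomologicalConductorPersistenceKC3CaLoc
import Summits.ResolutionOfSingularities.ResolutionOfSingularities.Theorems.HomologicalConductorPersistenceKC3NotMemCaLocW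
import Summits.ResolutionOfSingularities.ResolutionOfSingularities.Theorems.HomologicalConductorPersistenceKC3XbLattice
import Summits.ResolutionOfSingularities.ResolutionOfSingularities.Theorems.HomologicalConductorPersistenceKC3Glue
import HarnessLib

/-!
# Crux `Persistence` (stmt-ResolutionOfSingularities-16484) IS FALSE — the K-C3 counterexample, TOP-LEVEL ASSEMBLY (`not_Persistence`)
# (line `kc3` of record; chain W4.4b, K-C3 §H2L object K5; holder of record res-L1-w44b-lead-1)

[OURS · L1 w44b] AI-written and AI-refereed only (weaker than expert review). NOT a statement of the manuscript under
study (Hironaka 2017) and no statement of it is used. Everything below is summit-side.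

THE LINE. `Persistence` says: along the canonical normalised `ca`-tower `T₀ = loc O A`,
`T_{m+1} = loc O (nrm (chart O T_m))` of ANY datum `(p, k, K, O, A)`, `ca(T_m) ⊆ ca(T_{m+1})` for every `m`.
The K-C3 datum (KC3 SPELLING v1.1 of the chain): `k` a field of characteristic `5` (any `p ≥ 5` with `√-1 ∈ k` works;
`k = ZMod 5`, `i = 2`), `K = k(x,z,t) = FractionRing k[X₀,X₁,X₂]`, `A = k[x, z, t, (z³+t⁴)x⁻¹]` (the `E₆` compound Du Val
point `xy = z³ + t⁴`), `O = O_w` the monomial valuation ring of weights `w = (6,5,4)` (`kc3Weight 1`), `m = 0`.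
* K2 (socket `stub_kc3_ca_loc_eq`): `ca(T₀) = (x, y, z², zt, t²)·T₀` — upper bound fact-free (res-type-010 K2-upper/K2c),
  lower bound by double branched covers + quotient ascent + the conductor of the cusp `z³ + t⁴` (res-type-011, stub-1, stub-2).
* K3 (IN THE TREE, consumed by name): `T₁ = loc O W`, `W = k[x, z, t, z²/x, zt/x, t²/x, z³/x²] = k[a,b,c]^{μ₆(1,2,3)}`
  (`PersistenceKC3NormalLoc.kc3_tower_one_eq_of_ca`, res-D-pv-043, res-D-pv-021; `W ⊆ O`: `PersistenceMonomialValuation.kc3_W_subset`,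
  res-type-084).
* K4 (socket `stub_kc3_x_not_mem_ca_locW`): `x ∉ ca(loc O W)` — the non-equivariant rank-5 MCM witness `X_b` over the
  Frobenius `k[a⁶,b³,c²]`-order `W` (res-D-pv-058 K4a–c, res-D-pv-037 K4d, K4e).
* K5 (this file): `x ∈ ca(T₀)`, `x ∉ ca(T₁)` ⇒ `¬ (ca T₀ ⊆ ca T₁)` ⇒ `¬ Persistence`.

ROUTE HYGIENE (CHAIN v13 §V13.11.3): this skeleton is a crux WORKFILE; the Theorems landing is the negative-lemma vehicle
`--supports stmt-…-16484` until priority8 rules on the retriage of `Persistence`; no `--kind refutation` is filed from it.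
-/

noncomputable section

-- single-problem summit: the doubled namespace component `ResolutionOfSingularities` is forced
set_option linter.dupNamespace false

open MvPolynomial
open Summit.ResolutionOfSingularities.ResolutionOfSingularities.Theses.HomologicalConductor
open Summit.ResolutionOfSingularities.ResolutionOfSingularities.Theorems.NoZeno.Birth
open Summit.ResolutionOfSingularities.ResolutionOfSingularities.Theorems.HomologicalConductor

namespace Summit.ResolutionOfSingularities.ResolutionOfSingularities.Theorems.HomologicalConductor.PersistenceKC3

/-! ## §0 The K-C3 datum (KC3 SPELLING v1.1, local notation only) -/

variable (k : Type) [Field k]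

/-- `K = k(x,z,t)`. -/
local notation3 "𝕂" => FractionRing (MvPolynomial (Fin 3) k)
/-- `x`. -/
local notation3 "𝔵" => algebraMap (MvPolynomial (Fin 3) k) (FractionRing (MvPolynomial (Fin 3) k)) (MvPolynomial.X 0)
/-- `z`. -/
local notation3 "𝔷" => algebraMap (MvPolynomial (Fin 3) k) (FractionRing (MvPolynomial (Fin 3) k)) (MvPolynomial.X 1)
/-- `t`. -/
local notation3 "𝔱" => algebraMap (MvPolynomial (Fin 3) k) (FractionRing (MvPolynomial (Fin 3) k)) (MvPolynomial.X 2)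
/-- `O = O_w`, `w = (6,5,4)`. -/
local notation3 "𝕆" => PersistenceMonomialValuation.monomialValuationRing k
  (PersistenceMonomialValuation.kc3Weight 1) (FractionRing (MvPolynomial (Fin 3) k))
/-- `W = k[x, z, t, z²x⁻¹, ztx⁻¹, t²x⁻¹, z³x⁻¹x⁻¹]`, spelled EXACTLY as in `kc3_tower_one_eq`. -/
local notation3 "𝕎" => (Algebra.adjoin k
  ({algebraMap (MvPolynomial (Fin 3) k) (FractionRing (MvPolynomial (Fin 3) k)) (MvPolynomial.X 0),
    algebraMap (MvPolynomial (Fin 3) k) (FractionRing (MvPolynomial (Fin 3) k)) (MvPolynomial.X 1),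
    algebraMap (MvPolynomial (Fin 3) k) (FractionRing (MvPolynomial (Fin 3) k)) (MvPolynomial.X 2),
    algebraMap (MvPolynomial (Fin 3) k) (FractionRing (MvPolynomial (Fin 3) k)) (MvPolynomial.X 1) ^ 2 *
      (algebraMap (MvPolynomial (Fin 3) k) (FractionRing (MvPolynomial (Fin 3) k)) (MvPolynomial.X 0))⁻¹,
    algebraMap (MvPolynomial (Fin 3) k) (FractionRing (MvPolynomial (Fin 3) k)) (MvPolynomial.X 1) *
      algebraMap (MvPolynomial (Fin 3) k) (FractionRing (MvPolynomial (Fin 3) k)) (MvPolynomial.X 2) *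
      (algebraMap (MvPolynomial (Fin 3) k) (FractionRing (MvPolynomial (Fin 3) k)) (MvPolynomial.X 0))⁻¹,
    algebraMap (MvPolynomial (Fin 3) k) (FractionRing (MvPolynomial (Fin 3) k)) (MvPolynomial.X 2) ^ 2 *
      (algebraMap (MvPolynomial (Fin 3) k) (FractionRing (MvPolynomial (Fin 3) k)) (MvPolynomial.X 0))⁻¹,
    algebraMap (MvPolynomial (Fin 3) k) (FractionRing (MvPolynomial (Fin 3) k)) (MvPolynomial.X 1) ^ 3 *
      (algebraMap (MvPolynomial (Fin 3) k) (FractionRing (MvPolynomial (Fin 3) k)) (MvPolynomial.X 0))⁻¹ *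
      (algebraMap (MvPolynomial (Fin 3) k) (FractionRing (MvPolynomial (Fin 3) k)) (MvPolynomial.X 0))⁻¹} :
    Set (FractionRing (MvPolynomial (Fin 3) k))) : Subalgebra k (FractionRing (MvPolynomial (Fin 3) k)))
/-- `A = k[x, z, t, (z³+t⁴)x⁻¹]`, spelled EXACTLY as in `kc3_tower_one_eq`. -/
local notation3 "𝔸" => (Algebra.adjoin k
  ({algebraMap (MvPolynomial (Fin 3) k) (FractionRing (MvPolynomial (Fin 3) k)) (MvPolynomial.X 0),
    algebraMap (MvPolynomial (Fin 3) k) (FractionRing (MvPolynomial (Fin 3) k)) (MvPolynomial.X 1),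
    algebraMap (MvPolynomial (Fin 3) k) (FractionRing (MvPolynomial (Fin 3) k)) (MvPolynomial.X 2),
    (algebraMap (MvPolynomial (Fin 3) k) (FractionRing (MvPolynomial (Fin 3) k)) (MvPolynomial.X 1) ^ 3 +
        algebraMap (MvPolynomial (Fin 3) k) (FractionRing (MvPolynomial (Fin 3) k)) (MvPolynomial.X 2) ^ 4) *
      (algebraMap (MvPolynomial (Fin 3) k) (FractionRing (MvPolynomial (Fin 3) k)) (MvPolynomial.X 0))⁻¹} :
    Set (FractionRing (MvPolynomial (Fin 3) k))) : Subalgebra k (FractionRing (MvPolynomial (Fin 3) k)))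

/-! ## §1 Registered sockets (stubs) -/

/-! Socket K2 (`ca(T₀) = (x, y, z², zt, t²)·T₀`) is CLOSED in the tree: `PersistenceKC3.stub_kc3_ca_loc_eq` /
`PersistenceKC3.kc3_ca_loc_eq` (`…PersistenceKC3CaLoc.lean`, p539948; res-type-010 ⊆, res-L1-w44b-stub-2 ⊇ affine +
res-type-010 transport, assembled by the lead). Only socket K4 remains below. -/

/-! Socket K4 (`x ∉ ca(T₁)`) is CLOSED in the tree MODULO K4e: `PersistenceKC3.kc3_x_not_mem_ca_locW_of_projective`
(`…PersistenceKC3NotMemCaLocW.lean`, p540890; res-D-pv-058 K4c + res-D-pv-037 K4d + lead-1 α/β). The one remaining input: -/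

/-- **Socket K4e** (the last input of the line): the `W₀`-module `X_b = W₀⁸ ⧸ ∂·W₀¹²` of record
(res-D-pv-058 `KC3WitnessBaseChange.kc3Xb`) is projective over `P₀ = k[a⁶,b³,c²]` — res-D-pv-058's K4e instance
(`…KC3XbGens` / `…KC3XbSpan` / `…KC3XbLattice`: 18 clean pivots, `X_b ≅ P₀³⁰`), found by instance search. [OURS · L1 w44b · K-C3 K4e] -/
theorem kc3Xb_projective' : Module.Projective ↥(KC3FrobeniusOrder.kc3P k) (KC3WitnessBaseChange.kc3Xb k) :=
  KC3XbLattice.kc3Xb_projective (k := k)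

/-! ## §2 Bookkeeping at the datum (fact-free, proved here) -/

/-- `x ∈ ca(T₀)` from socket K2 (`x = 1·x`). [OURS · L1 w44b · K-C3] -/
theorem kc3_x_mem_ca_loc_of_eq
    (hca : ca (loc 𝕆 𝔸) =
      {c : 𝕂 | ∃ α β γ δ ε : 𝕂, α ∈ loc 𝕆 𝔸 ∧ β ∈ loc 𝕆 𝔸 ∧ γ ∈ loc 𝕆 𝔸 ∧ δ ∈ loc 𝕆 𝔸 ∧ ε ∈ loc 𝕆 𝔸 ∧
        c = α * 𝔵 + β * ((𝔷 ^ 3 + 𝔱 ^ 4) * 𝔵⁻¹) + γ * 𝔷 ^ 2 + δ * (𝔷 * 𝔱) + ε * 𝔱 ^ 2}) :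
    (𝔵 : 𝕂) ∈ ca (loc 𝕆 𝔸) := by
  rw [hca]
  refine ⟨1, 0, 0, 0, 0, (loc 𝕆 𝔸).one_mem, (loc 𝕆 𝔸).zero_mem, (loc 𝕆 𝔸).zero_mem, (loc 𝕆 𝔸).zero_mem,
    (loc 𝕆 𝔸).zero_mem, by ring⟩

/-! ## §3 The composition: K2 + K3 + K4 ⇒ `¬ Persistence` -/

/-- **`Persistence` over the named tower** (re-abstraction of one term, as `NoZeno.Birth.noZeno_iff`): the crux implies
`ca (tower O A m) ⊆ ca (tower O A (m+1))` for every datum and every `m`. Nothing is claimed. [folklore] -/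
theorem tower_persistence_of_persistence (hP : Persistence) :
    ∀ p : ℕ, p.Prime → ∀ (k K : Type) [Field k] [CharP k p] [Field K] [Algebra k K] (O : ValuationSubring K)
      (A : Subalgebra k K), (∀ c : k, algebraMap k K c ∈ O) → A.FG → IsFractionRing ↥A K →
      A.toSubring ≤ O.toSubring → ∀ m : ℕ, ca (tower O A m) ⊆ ca (tower O A (m + 1)) :=
  fun p hp k K _ _ _ _ O A hk hfg hfr hAO => hP p hp k K O A hk hfg hfr hAO


/-- **K5 over a general ground field.** If, for SOME field `k` of prime characteristic `p`, the K-C3 tower over `k` has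
`ca(T₀) = (x,y,z²,zt,t²)·T₀` and `x ∉ ca(loc O W)`, then `Persistence` fails: `T₁ = loc O W` by the tower step
(`kc3_tower_one_eq_of_ca`), `x ∈ ca(T₀)`, `x ∉ ca(T₁)`. [OURS · L1 w44b · K-C3 K5] -/
theorem persistence_false_of_kc3 (p : ℕ) (hp : p.Prime) [CharP k p]
    (hca : ca (loc 𝕆 𝔸) =
      {c : 𝕂 | ∃ α β γ δ ε : 𝕂, α ∈ loc 𝕆 𝔸 ∧ β ∈ loc 𝕆 𝔸 ∧ γ ∈ loc 𝕆 𝔸 ∧ δ ∈ loc 𝕆 𝔸 ∧ ε ∈ loc 𝕆 𝔸 ∧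
        c = α * 𝔵 + β * ((𝔷 ^ 3 + 𝔱 ^ 4) * 𝔵⁻¹) + γ * 𝔷 ^ 2 + δ * (𝔷 * 𝔱) + ε * 𝔱 ^ 2})
    (hx : (𝔵 : 𝕂) ∉ ca (loc 𝕆 𝕎)) : ¬ Persistence := by
  intro hP
  have hWO := PersistenceMonomialValuation.kc3_W_subset k 𝕂 1
  have h01 : ca (tower 𝕆 𝔸 0) ⊆ ca (tower 𝕆 𝔸 (0 + 1)) :=
    tower_persistence_of_persistence hP p hp k 𝕂 𝕆 𝔸 (PersistenceMonomialValuation.kc3_algebraMap_base_mem k 𝕂 1)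
      KC3Glue.kc3_A_fg KC3Glue.kc3_isFractionRing_A (PersistenceMonomialValuation.kc3_adjoin_toSubring_le k 𝕂 1) 0
  rw [zero_add, tower_zero, PersistenceKC3NormalLoc.kc3_tower_one_eq_of_ca 𝕆 hWO hca] at h01
  exact hx (h01 (kc3_x_mem_ca_loc_of_eq k hca))

/-- **K5 modulo K4e, every field of characteristic `≠ 2`**: if `X_b` is `P₀`-projective then `Persistence` fails.
[OURS · L1 w44b · K-C3 K5] -/
theorem persistence_false_of_kc3XbProjective (p : ℕ) (hp : p.Prime) [CharP k p] (h2 : (2 : k) ≠ 0)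
    [Module.Projective ↥(KC3FrobeniusOrder.kc3P k) (KC3WitnessBaseChange.kc3Xb k)] : ¬ Persistence :=
  persistence_false_of_kc3 k p hp (kc3_ca_loc_eq k h2) (kc3_x_not_mem_ca_locW_of_projective k)

end Summit.ResolutionOfSingularities.ResolutionOfSingularities.Theorems.HomologicalConductor.PersistenceKC3

/-! ## §4 The line's conclusion BY NAME at `k = ZMod 5` (`i = 2`, `2² = -1`) -/

namespace Summit.ResolutionOfSingularities.ResolutionOfSingularities.Theorems

open HomologicalConductor.PersistenceKC3

/-- `2 ≠ 0` in `ZMod 5`. [folklore] -/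
theorem zmod5_two_ne_zero : (2 : ZMod 5) ≠ 0 := by decide

/-- **`Persistence` IS FALSE — refuted-MISSTATED; repaired: `PersistenceRadical`** (the radical form `√ca(T_m) ⊆ √ca(T_{m+1})`,
decl `Theses.HomologicalConductor.PersistenceRadical`, PROVED: `Theorems.persistenceRadical_proof`, p471149 — the statement the route's
deciding theorem `closes` binds). Witness (K-C3, chain W4.4b; the datum verbatim): `p = 5`, `k = ZMod 5`, `K = k(x,z,t)`,
`A = k[x, z, t, (z³+t⁴)/x]` (the `E₆` compound Du Val threefold point `xy = z³ + t⁴`), `O = O_(6,5,4)` the monomial valuation ring of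
weights `(6,5,4)` on `(x,z,t)`, `m = 0`: **`x ∈ ca(T₀) ∖ ca(T₁)`** — `ca(T₀) = (x, y, z², zt, t²)·T₀` (two-sided, fact-free: Jacobian +
quotient ascent + conductor of the cusp `u² = z³ + t⁴`), `T₁ = loc O W`, `W = k[x, z, t, z²/x, zt/x, t²/x, z³/x²] ≅ k[a,b,c]^{μ₆(1,2,3)}`, and
`x = a⁶ ∉ ca(T₁)` (the rank-5 maximal Cohen–Macaulay lattice `X_b` over the Frobenius order `W ⊇ k[a⁶,b³,c²]`, on which `x·1` is not stably
zero at any localisation with unit constant terms). The exponent-one formulation is the misstatement: at this step `x² = a¹² ∈ ca(T₁)` (loss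
factor 2), and the witness misses the radical form. [OURS · L1 w44b · K-C3 K5 — AI-written and AI-refereed only (weaker than expert review);
NOT a statement of the manuscript under study; nothing here claims anything about resolution of singularities in characteristic p] -/
theorem not_Persistence : ¬ Persistence := by
  haveI : Fact (Nat.Prime 5) := ⟨Nat.prime_five⟩
  haveI := kc3Xb_projective' (ZMod 5)
  exact persistence_false_of_kc3XbProjective (ZMod 5) 5 Nat.prime_five zmod5_two_ne_zero

end Summit.ResolutionOfSingularities.ResolutionOfSingularities.Theorems

end
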